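import Summits.NavierStokesRegularity.NavierStokesRegularity.Theses.TypeICertificateLadder
import Summits.NavierStokesRegularity.NavierStokesRegularity.Theorems.TypeICertificateLadderTargetHeadFluxCriterion
import Literature.Analysis.FluidPDE.TypeIAncientMildClassical
import Literature.Analysis.FluidPDE.AncientSimilarityVariables

/-!
# `Target` (stmt-NavierStokesRegularity-1217), line `head-flux-channel`:
# the head-influx law `stub_headInfluxLaw` (S4) IS the rate-class Type-I Liouville theorem,
# level by level (kernel-checked "costume" lemma)

Negative-lane lemma for the crux work on `TypeICertificateLadder.NoTypeIBlowup` (drefute seat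
refuter-drefute-stmt-NavierStokesRegularity-1217-g3-0, 2026-08-16), supporting the line skeleton
`Cruxes/Target/Lines/head-flux-channel.lean` (lead's reshape, 7 stubs, sha 2258e0fb…). No
definitions; no conclusion asserts a route item.

Write, at a FIXED level `C`,
* `Liouville(C)` : every `u` with `IsTypeIAncientMild C u` vanishes on `t < 0`;
* `S1b(C)`, `S2a(C)`, `S2b(C)`, `S2c(C)`, `S4(C)` : the skeleton's stubs `stub_ancientPressure`,
  `stub_gaussianDissipationContinuous`, `stub_gaussianChannelContinuous`, `stub_gaussianEnergyDeriv`,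
  `stub_headInfluxLaw` instantiated at `C` (all spelled out verbatim below, no local names).

Findings (all three triage rounds and drefute gen-1/gen-2 said this in prose; here it is a theorem):
1. `stub_headInfluxLaw_of_liouville` : `Liouville(C) → S4(C)` — unconditionally, for every scalar
   field `p` (the classical-pressure hypothesis is not even used): the class is `{0}`, the Leray
   orbit vanishes, both sides of the law are `0`, take `ε = ½`, `S₀ = 0`.
2. `liouville_of_stub_headInfluxLaw` : `S1b(C) → S2a(C) → S2b(C) → S2c(C) → S4(C) → Liouville(C)`,
   by the LANDED S3 `Theorems.stub_headFluxCriterion` (p75227).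
3. `stub_headInfluxLaw_iff_liouville` : under `S1b(C) ∧ S2a(C) ∧ S2b(C) ∧ S2c(C)` (all TRUE —
   S1b is proved in `Cruxes/Target/S1bProof.lean`, S2 is Giga–Kohn calculus, cf. the accepted
   sibling-route file `Theorems/RellichScarSymmetricScarExistsGaussianWindowLaw.lean`, which proves
   the same Gaussian window identity `½(∫|U|²g)' = −(∫|DU|²g + ½∫|U|²g + ½∫(P+½|U|²)(y·U)g)` for
   eternal backward-Leray profiles with weighted bounds), `S4(C) ↔ Liouville(C)`.
   So S4 is not a lemma of the line: at each level it carries exactly the content of the crux's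
   profile-side statement (Type-I Liouville in the Oseen-gauge rate class at level `C`), no more
   and no less: any proof of `S4(C)`, composed with the (true) calculus stubs S1b–S3, is a proof of
   `Liouville(C)`, and conversely `Liouville(C)` gives `S4(C)` in two lines — S4 cannot be easier
   than the crux's profile-side statement at that level.
4. `not_stub_headInfluxLaw_of_nontrivial` : a single nontrivial class element at level `C` (with
   S1b, S2 at `C`) refutes `S4(C)` — the adversary's target for S4 is literally a Type-I ancient
   mild solution, i.e. (modulo the zoom S1a) a Type-I singularity.
5. `stub_headInfluxLaw_antitone` : `C' ≤ C → S4(C) → S4(C')` (class inclusion), so the set of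
   levels where S4 holds is a down-set `[−∞, C*)`/`[−∞, C*]`, exactly like the rungs of the host
   ladder; with the tree's ancient Leray threshold (`exists_typeIAncientMild_eq_zero_of_small`,
   used in gen-2's `S4SmallC.lean`) it contains `(−∞, ε]`.
6. `headInflux_le_budget_add_const` (tightness): for EVERY class element and every `p` with S2 at
   `(u,p)`, on every window `∫ₐᵇ(−½Ch) ≤ ∫ₐᵇ(D+E) + ½C²∫G` — the law with `ε = 0` up to an additive
   constant is free (FTC form of (GE), `influx_sub_budget_eq`); S4's whole content is the
   multiplicative gap.

[folklore]
-/

noncomputable section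

namespace Summit.NavierStokesRegularity.NavierStokesRegularity.Theorems.TargetNegative.HeadInfluxLawCostume

set_option linter.dupNamespace false

open MeasureTheory Set Filter Topology Function
open scoped RealInnerProductSpace
open Literature.Analysis.FluidPDE

/-- **`Liouville(C) → S4(C)`.** If the class `IsTypeIAncientMild C` is trivial on `t < 0`, the
head-influx law of the skeleton holds at level `C` for every scalar field `p` (with `ε = ½`,
`S₀ = 0`): the Leray orbit and its gradient vanish, so both window integrals are `0`. [folklore] -/
theorem stub_headInfluxLaw_of_liouville (C : ℝ)
    (hL : ∀ u : ℝ → EuclideanSpace ℝ (Fin 3) → EuclideanSpace ℝ (Fin 3),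
      IsTypeIAncientMild C u → ∀ t < 0, ∀ x, u t x = 0) :
    ∀ (u : ℝ → EuclideanSpace ℝ (Fin 3) → EuclideanSpace ℝ (Fin 3))
      (p : ℝ → EuclideanSpace ℝ (Fin 3) → ℝ),
      IsTypeIAncientMild C u →
      ∃ ε : ℝ, 0 < ε ∧ ∃ S₀ : ℝ, ∀ a b : ℝ, a + S₀ ≤ b →
        (∫ s in a..b, -(∫ y, (‖lerayOrbit u s y‖ ^ 2 / 2 + lerayOrbitPressure p s y) *
            ⟪y, lerayOrbit u s y⟫ * Real.exp (-‖y‖ ^ 2 / 4)) / 2) ≤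
          (1 - ε) * ∫ s in a..b,
            ((∫ y, frobeniusNormSq (fderiv ℝ (lerayOrbit u s) y) * Real.exp (-‖y‖ ^ 2 / 4)) +
              ∫ y, ‖lerayOrbit u s y‖ ^ 2 / 2 * Real.exp (-‖y‖ ^ 2 / 4)) := by
  intro u p hA
  refine ⟨1 / 2, by norm_num, 0, fun a b _ => ?_⟩
  have hz : ∀ t < 0, ∀ x, u t x = 0 := hL u hA
  have hU : ∀ s : ℝ, lerayOrbit u s = fun _ => 0 := fun s => by
    funext y
    rw [lerayOrbit_apply, hz _ (neg_exp_neg_lt_zero s), smul_zero]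
  have hUy : ∀ (s : ℝ) (y : EuclideanSpace ℝ (Fin 3)), lerayOrbit u s y = 0 := fun s y => by
    rw [hU s]
  have hfd : ∀ (s : ℝ) (y : EuclideanSpace ℝ (Fin 3)), fderiv ℝ (lerayOrbit u s) y = 0 :=
    fun s y => by rw [hU s]; simp
  simp only [hUy, hfd, frobeniusNormSq_zero, norm_zero, inner_zero_right, mul_zero, zero_mul,
    integral_zero, neg_zero, zero_div, intervalIntegral.integral_zero]
  norm_num

/-- **`Liouville(C) → S4(C)`, in the exact shape of the stub at level `C`** (the classical-pressure
hypothesis is carried unused). [folklore] -/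
theorem stub_headInfluxLaw_of_liouville' (C : ℝ)
    (hL : ∀ u : ℝ → EuclideanSpace ℝ (Fin 3) → EuclideanSpace ℝ (Fin 3),
      IsTypeIAncientMild C u → ∀ t < 0, ∀ x, u t x = 0) :
    ∀ (u : ℝ → EuclideanSpace ℝ (Fin 3) → EuclideanSpace ℝ (Fin 3))
      (p : ℝ → EuclideanSpace ℝ (Fin 3) → ℝ),
      IsTypeIAncientMild C u → IsClassicalNSSolutionOn (Set.Iio 0) 1 0 u p →
      ∃ ε : ℝ, 0 < ε ∧ ∃ S₀ : ℝ, ∀ a b : ℝ, a + S₀ ≤ b →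
        (∫ s in a..b, -(∫ y, (‖lerayOrbit u s y‖ ^ 2 / 2 + lerayOrbitPressure p s y) *
            ⟪y, lerayOrbit u s y⟫ * Real.exp (-‖y‖ ^ 2 / 4)) / 2) ≤
          (1 - ε) * ∫ s in a..b,
            ((∫ y, frobeniusNormSq (fderiv ℝ (lerayOrbit u s) y) * Real.exp (-‖y‖ ^ 2 / 4)) +
              ∫ y, ‖lerayOrbit u s y‖ ^ 2 / 2 * Real.exp (-‖y‖ ^ 2 / 4)) :=
  fun u p hA _ => stub_headInfluxLaw_of_liouville C hL u p hA

/-- **`S1b(C) → S2a(C) → S2b(C) → S2c(C) → S4(C) → Liouville(C)`**: at a fixed level `C`, the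
head-influx law together with the (true, calculus) stubs S1b and S2a–S2c forces every Type-I
ancient mild field of the level to vanish, by the landed head-flux criterion S3
(`Theorems.stub_headFluxCriterion`). [folklore] -/
theorem liouville_of_stub_headInfluxLaw (C : ℝ)
    (hS1b : ∀ u : ℝ → EuclideanSpace ℝ (Fin 3) → EuclideanSpace ℝ (Fin 3),
      IsTypeIAncientMild C u →
      ∃ q : ℝ → EuclideanSpace ℝ (Fin 3) → ℝ, IsClassicalNSSolutionOn (Set.Iio 0) 1 0 u q)
    (hS2a : ∀ u : ℝ → EuclideanSpace ℝ (Fin 3) → EuclideanSpace ℝ (Fin 3),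
      IsTypeIAncientMild C u →
      Continuous (fun s : ℝ =>
          ∫ y, frobeniusNormSq (fderiv ℝ (lerayOrbit u s) y) * Real.exp (-‖y‖ ^ 2 / 4)))
    (hS2b : ∀ (u : ℝ → EuclideanSpace ℝ (Fin 3) → EuclideanSpace ℝ (Fin 3))
      (p : ℝ → EuclideanSpace ℝ (Fin 3) → ℝ),
      IsTypeIAncientMild C u → IsClassicalNSSolutionOn (Set.Iio 0) 1 0 u p →
      Continuous (fun s : ℝ =>
          ∫ y, (‖lerayOrbit u s y‖ ^ 2 / 2 + lerayOrbitPressure p s y) *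
            ⟪y, lerayOrbit u s y⟫ * Real.exp (-‖y‖ ^ 2 / 4)))
    (hS2c : ∀ (u : ℝ → EuclideanSpace ℝ (Fin 3) → EuclideanSpace ℝ (Fin 3))
      (p : ℝ → EuclideanSpace ℝ (Fin 3) → ℝ),
      IsTypeIAncientMild C u → IsClassicalNSSolutionOn (Set.Iio 0) 1 0 u p →
      ∀ s : ℝ,
        HasDerivAt (fun σ : ℝ => ∫ y, ‖lerayOrbit u σ y‖ ^ 2 / 2 * Real.exp (-‖y‖ ^ 2 / 4))
          (-(∫ y, frobeniusNormSq (fderiv ℝ (lerayOrbit u s) y) * Real.exp (-‖y‖ ^ 2 / 4))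
            - (∫ y, ‖lerayOrbit u s y‖ ^ 2 / 2 * Real.exp (-‖y‖ ^ 2 / 4))
            - (∫ y, (‖lerayOrbit u s y‖ ^ 2 / 2 + lerayOrbitPressure p s y) *
                ⟪y, lerayOrbit u s y⟫ * Real.exp (-‖y‖ ^ 2 / 4)) / 2) s)
    (hS4 : ∀ (u : ℝ → EuclideanSpace ℝ (Fin 3) → EuclideanSpace ℝ (Fin 3))
      (p : ℝ → EuclideanSpace ℝ (Fin 3) → ℝ),
      IsTypeIAncientMild C u → IsClassicalNSSolutionOn (Set.Iio 0) 1 0 u p →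
      ∃ ε : ℝ, 0 < ε ∧ ∃ S₀ : ℝ, ∀ a b : ℝ, a + S₀ ≤ b →
        (∫ s in a..b, -(∫ y, (‖lerayOrbit u s y‖ ^ 2 / 2 + lerayOrbitPressure p s y) *
            ⟪y, lerayOrbit u s y⟫ * Real.exp (-‖y‖ ^ 2 / 4)) / 2) ≤
          (1 - ε) * ∫ s in a..b,
            ((∫ y, frobeniusNormSq (fderiv ℝ (lerayOrbit u s) y) * Real.exp (-‖y‖ ^ 2 / 4)) +
              ∫ y, ‖lerayOrbit u s y‖ ^ 2 / 2 * Real.exp (-‖y‖ ^ 2 / 4))) :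
    ∀ u : ℝ → EuclideanSpace ℝ (Fin 3) → EuclideanSpace ℝ (Fin 3),
      IsTypeIAncientMild C u → ∀ t < 0, ∀ x, u t x = 0 := by
  intro u hA
  obtain ⟨q, hq⟩ := hS1b u hA
  exact Summit.NavierStokesRegularity.NavierStokesRegularity.Theorems.stub_headFluxCriterion C u q hA
    (hS2a u hA) (hS2b u q hA hq) (hS2c u q hA hq) (hS4 u q hA hq)

/-- **S4 is Liouville in costume, level by level.** Under the true calculus stubs S1b, S2a, S2b,
S2c at level `C`, the head-influx law `S4(C)` holds if and only if the class `IsTypeIAncientMild C`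
is trivial on `t < 0`. [folklore] -/
theorem stub_headInfluxLaw_iff_liouville (C : ℝ)
    (hS1b : ∀ u : ℝ → EuclideanSpace ℝ (Fin 3) → EuclideanSpace ℝ (Fin 3),
      IsTypeIAncientMild C u →
      ∃ q : ℝ → EuclideanSpace ℝ (Fin 3) → ℝ, IsClassicalNSSolutionOn (Set.Iio 0) 1 0 u q)
    (hS2a : ∀ u : ℝ → EuclideanSpace ℝ (Fin 3) → EuclideanSpace ℝ (Fin 3),
      IsTypeIAncientMild C u →
      Continuous (fun s : ℝ =>
          ∫ y, frobeniusNormSq (fderiv ℝ (lerayOrbit u s) y) * Real.exp (-‖y‖ ^ 2 / 4)))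
    (hS2b : ∀ (u : ℝ → EuclideanSpace ℝ (Fin 3) → EuclideanSpace ℝ (Fin 3))
      (p : ℝ → EuclideanSpace ℝ (Fin 3) → ℝ),
      IsTypeIAncientMild C u → IsClassicalNSSolutionOn (Set.Iio 0) 1 0 u p →
      Continuous (fun s : ℝ =>
          ∫ y, (‖lerayOrbit u s y‖ ^ 2 / 2 + lerayOrbitPressure p s y) *
            ⟪y, lerayOrbit u s y⟫ * Real.exp (-‖y‖ ^ 2 / 4)))
    (hS2c : ∀ (u : ℝ → EuclideanSpace ℝ (Fin 3) → EuclideanSpace ℝ (Fin 3))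
      (p : ℝ → EuclideanSpace ℝ (Fin 3) → ℝ),
      IsTypeIAncientMild C u → IsClassicalNSSolutionOn (Set.Iio 0) 1 0 u p →
      ∀ s : ℝ,
        HasDerivAt (fun σ : ℝ => ∫ y, ‖lerayOrbit u σ y‖ ^ 2 / 2 * Real.exp (-‖y‖ ^ 2 / 4))
          (-(∫ y, frobeniusNormSq (fderiv ℝ (lerayOrbit u s) y) * Real.exp (-‖y‖ ^ 2 / 4))
            - (∫ y, ‖lerayOrbit u s y‖ ^ 2 / 2 * Real.exp (-‖y‖ ^ 2 / 4))
            - (∫ y, (‖lerayOrbit u s y‖ ^ 2 / 2 + lerayOrbitPressure p s y) *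
                ⟪y, lerayOrbit u s y⟫ * Real.exp (-‖y‖ ^ 2 / 4)) / 2) s) :
    (∀ (u : ℝ → EuclideanSpace ℝ (Fin 3) → EuclideanSpace ℝ (Fin 3))
      (p : ℝ → EuclideanSpace ℝ (Fin 3) → ℝ),
      IsTypeIAncientMild C u → IsClassicalNSSolutionOn (Set.Iio 0) 1 0 u p →
      ∃ ε : ℝ, 0 < ε ∧ ∃ S₀ : ℝ, ∀ a b : ℝ, a + S₀ ≤ b →
        (∫ s in a..b, -(∫ y, (‖lerayOrbit u s y‖ ^ 2 / 2 + lerayOrbitPressure p s y) *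
            ⟪y, lerayOrbit u s y⟫ * Real.exp (-‖y‖ ^ 2 / 4)) / 2) ≤
          (1 - ε) * ∫ s in a..b,
            ((∫ y, frobeniusNormSq (fderiv ℝ (lerayOrbit u s) y) * Real.exp (-‖y‖ ^ 2 / 4)) +
              ∫ y, ‖lerayOrbit u s y‖ ^ 2 / 2 * Real.exp (-‖y‖ ^ 2 / 4))) ↔
    (∀ u : ℝ → EuclideanSpace ℝ (Fin 3) → EuclideanSpace ℝ (Fin 3),
      IsTypeIAncientMild C u → ∀ t < 0, ∀ x, u t x = 0) :=
  ⟨liouville_of_stub_headInfluxLaw C hS1b hS2a hS2b hS2c, stub_headInfluxLaw_of_liouville' C⟩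

/-- **The adversary's target for S4 is a Type-I ancient mild solution.** Given the calculus stubs
S1b, S2a–S2c at level `C`, ONE nontrivial element of `IsTypeIAncientMild C` refutes the head-influx
law at level `C` (contrapositive of `liouville_of_stub_headInfluxLaw`). [folklore] -/
theorem not_stub_headInfluxLaw_of_nontrivial (C : ℝ)
    (hex : ∃ u : ℝ → EuclideanSpace ℝ (Fin 3) → EuclideanSpace ℝ (Fin 3),
      IsTypeIAncientMild C u ∧ ¬ ∀ t < 0, ∀ x, u t x = 0)
    (hS1b : ∀ u : ℝ → EuclideanSpace ℝ (Fin 3) → EuclideanSpace ℝ (Fin 3),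
      IsTypeIAncientMild C u →
      ∃ q : ℝ → EuclideanSpace ℝ (Fin 3) → ℝ, IsClassicalNSSolutionOn (Set.Iio 0) 1 0 u q)
    (hS2a : ∀ u : ℝ → EuclideanSpace ℝ (Fin 3) → EuclideanSpace ℝ (Fin 3),
      IsTypeIAncientMild C u →
      Continuous (fun s : ℝ =>
          ∫ y, frobeniusNormSq (fderiv ℝ (lerayOrbit u s) y) * Real.exp (-‖y‖ ^ 2 / 4)))
    (hS2b : ∀ (u : ℝ → EuclideanSpace ℝ (Fin 3) → EuclideanSpace ℝ (Fin 3))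
      (p : ℝ → EuclideanSpace ℝ (Fin 3) → ℝ),
      IsTypeIAncientMild C u → IsClassicalNSSolutionOn (Set.Iio 0) 1 0 u p →
      Continuous (fun s : ℝ =>
          ∫ y, (‖lerayOrbit u s y‖ ^ 2 / 2 + lerayOrbitPressure p s y) *
            ⟪y, lerayOrbit u s y⟫ * Real.exp (-‖y‖ ^ 2 / 4)))
    (hS2c : ∀ (u : ℝ → EuclideanSpace ℝ (Fin 3) → EuclideanSpace ℝ (Fin 3))
      (p : ℝ → EuclideanSpace ℝ (Fin 3) → ℝ),
      IsTypeIAncientMild C u → IsClassicalNSSolutionOn (Set.Iio 0) 1 0 u p →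
      ∀ s : ℝ,
        HasDerivAt (fun σ : ℝ => ∫ y, ‖lerayOrbit u σ y‖ ^ 2 / 2 * Real.exp (-‖y‖ ^ 2 / 4))
          (-(∫ y, frobeniusNormSq (fderiv ℝ (lerayOrbit u s) y) * Real.exp (-‖y‖ ^ 2 / 4))
            - (∫ y, ‖lerayOrbit u s y‖ ^ 2 / 2 * Real.exp (-‖y‖ ^ 2 / 4))
            - (∫ y, (‖lerayOrbit u s y‖ ^ 2 / 2 + lerayOrbitPressure p s y) *
                ⟪y, lerayOrbit u s y⟫ * Real.exp (-‖y‖ ^ 2 / 4)) / 2) s) :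
    ¬ ∀ (u : ℝ → EuclideanSpace ℝ (Fin 3) → EuclideanSpace ℝ (Fin 3))
      (p : ℝ → EuclideanSpace ℝ (Fin 3) → ℝ),
      IsTypeIAncientMild C u → IsClassicalNSSolutionOn (Set.Iio 0) 1 0 u p →
      ∃ ε : ℝ, 0 < ε ∧ ∃ S₀ : ℝ, ∀ a b : ℝ, a + S₀ ≤ b →
        (∫ s in a..b, -(∫ y, (‖lerayOrbit u s y‖ ^ 2 / 2 + lerayOrbitPressure p s y) *
            ⟪y, lerayOrbit u s y⟫ * Real.exp (-‖y‖ ^ 2 / 4)) / 2) ≤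
          (1 - ε) * ∫ s in a..b,
            ((∫ y, frobeniusNormSq (fderiv ℝ (lerayOrbit u s) y) * Real.exp (-‖y‖ ^ 2 / 4)) +
              ∫ y, ‖lerayOrbit u s y‖ ^ 2 / 2 * Real.exp (-‖y‖ ^ 2 / 4)) := by
  intro hS4
  obtain ⟨u, hA, hnon⟩ := hex
  exact hnon (liouville_of_stub_headInfluxLaw C hS1b hS2a hS2b hS2c hS4 u hA)

/-- Class inclusion: `IsTypeIAncientMild C' u → C' ≤ C → IsTypeIAncientMild C u`
(only the Type-I bound depends on the constant). [folklore] -/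
theorem isTypeIAncientMild_of_le {C' C : ℝ}
    {u : ℝ → EuclideanSpace ℝ (Fin 3) → EuclideanSpace ℝ (Fin 3)}
    (h : IsTypeIAncientMild C' u) (hle : C' ≤ C) : IsTypeIAncientMild C u := by
  refine ⟨h.1, h.2.1, h.2.2.1, fun t ht x => (h.2.2.2 t ht x).trans ?_⟩
  exact div_le_div_of_nonneg_right hle (Real.sqrt_nonneg _)

/-- **The levels where S4 holds form a down-set**: `C' ≤ C → S4(C) → S4(C')` (class inclusion;
like the rungs `X_C` of the host ladder). [folklore] -/
theorem stub_headInfluxLaw_antitone {C' C : ℝ} (hle : C' ≤ C)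
    (hS4 : ∀ (u : ℝ → EuclideanSpace ℝ (Fin 3) → EuclideanSpace ℝ (Fin 3))
      (p : ℝ → EuclideanSpace ℝ (Fin 3) → ℝ),
      IsTypeIAncientMild C u → IsClassicalNSSolutionOn (Set.Iio 0) 1 0 u p →
      ∃ ε : ℝ, 0 < ε ∧ ∃ S₀ : ℝ, ∀ a b : ℝ, a + S₀ ≤ b →
        (∫ s in a..b, -(∫ y, (‖lerayOrbit u s y‖ ^ 2 / 2 + lerayOrbitPressure p s y) *
            ⟪y, lerayOrbit u s y⟫ * Real.exp (-‖y‖ ^ 2 / 4)) / 2) ≤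
          (1 - ε) * ∫ s in a..b,
            ((∫ y, frobeniusNormSq (fderiv ℝ (lerayOrbit u s) y) * Real.exp (-‖y‖ ^ 2 / 4)) +
              ∫ y, ‖lerayOrbit u s y‖ ^ 2 / 2 * Real.exp (-‖y‖ ^ 2 / 4))) :
    ∀ (u : ℝ → EuclideanSpace ℝ (Fin 3) → EuclideanSpace ℝ (Fin 3))
      (p : ℝ → EuclideanSpace ℝ (Fin 3) → ℝ),
      IsTypeIAncientMild C' u → IsClassicalNSSolutionOn (Set.Iio 0) 1 0 u p →
      ∃ ε : ℝ, 0 < ε ∧ ∃ S₀ : ℝ, ∀ a b : ℝ, a + S₀ ≤ b →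
        (∫ s in a..b, -(∫ y, (‖lerayOrbit u s y‖ ^ 2 / 2 + lerayOrbitPressure p s y) *
            ⟪y, lerayOrbit u s y⟫ * Real.exp (-‖y‖ ^ 2 / 4)) / 2) ≤
          (1 - ε) * ∫ s in a..b,
            ((∫ y, frobeniusNormSq (fderiv ℝ (lerayOrbit u s) y) * Real.exp (-‖y‖ ^ 2 / 4)) +
              ∫ y, ‖lerayOrbit u s y‖ ^ 2 / 2 * Real.exp (-‖y‖ ^ 2 / 4)) :=
  fun u p hA hcl => hS4 u p (isTypeIAncientMild_of_le hA hle) hcl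

/-! ### Tightness: the law at `ε = 0` is free for every class element -/

/-- **Influx minus budget is an exact derivative** (FTC form of (GE)): for real functions with
`D`, `Ch` continuous and `E' = -D - E - Ch/2` everywhere,
`∫ₐᵇ (-Ch/2) - ∫ₐᵇ (D + E) = E(b) - E(a)` on every window (any `a`, `b`). [folklore] -/
theorem influx_sub_budget_eq {E D Ch : ℝ → ℝ} (hDc : Continuous D) (hChc : Continuous Ch)
    (hderiv : ∀ s, HasDerivAt E (-(D s) - E s - Ch s / 2) s) (a b : ℝ) :
    (∫ s in a..b, -(Ch s) / 2) - (∫ s in a..b, (D s + E s)) = E b - E a := by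
  have hEc : Continuous E := continuous_iff_continuousAt.2 fun σ => (hderiv σ).continuousAt
  have I1 : IntervalIntegrable (fun σ => -(Ch σ) / 2) volume a b :=
    (hChc.neg.div_const 2).intervalIntegrable a b
  have I2 : IntervalIntegrable (fun σ => D σ + E σ) volume a b :=
    (hDc.add hEc).intervalIntegrable a b
  have I3 : IntervalIntegrable (fun σ => -(D σ) - E σ - Ch σ / 2) volume a b :=
    ((hDc.neg.sub hEc).sub (hChc.div_const 2)).intervalIntegrable a b
  have h1 : (∫ σ in a..b, (-(D σ) - E σ - Ch σ / 2)) = E b - E a :=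
    intervalIntegral.integral_eq_sub_of_hasDerivAt (fun σ _ => hderiv σ) I3
  rw [← h1, ← intervalIntegral.integral_sub I1 I2]
  refine intervalIntegral.integral_congr fun σ _ => ?_
  ring

/-- **The law with `ε = 0` and an additive constant holds for free**: if moreover `0 ≤ E ≤ M`, then
`∫ₐᵇ (-Ch/2) ≤ ∫ₐᵇ (D + E) + M` on every window. [folklore] -/
theorem influx_le_budget_add {E D Ch : ℝ → ℝ} {M : ℝ} (hE0 : ∀ s, 0 ≤ E s) (hEM : ∀ s, E s ≤ M)
    (hDc : Continuous D) (hChc : Continuous Ch)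
    (hderiv : ∀ s, HasDerivAt E (-(D s) - E s - Ch s / 2) s) (a b : ℝ) :
    (∫ s in a..b, -(Ch s) / 2) ≤ (∫ s in a..b, (D s + E s)) + M := by
  have h := influx_sub_budget_eq hDc hChc hderiv a b
  linarith [hE0 a, hEM b]

/-- **Tightness of S4: the head influx never exceeds the Gaussian budget by more than
`sup E ≤ ½C² ∫G`, for EVERY Type-I ancient mild field and every scalar `p` satisfying S2 at `(u, p)`**
(continuity of `D`, `Ch` and `E' = -D - E - ½Ch`): on every similarity-time window
`∫ₐᵇ (-½Ch) ≤ ∫ₐᵇ (D + E) + ½C² ∫ e^{-‖y‖²/4} dy`. So the law of `stub_headInfluxLaw` with `ε = 0`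
(up to an additive constant) carries no information; its entire content is the multiplicative gap
`ε > 0`, which by S3 is `∫_{-∞}^b (D + E) < ∞`, i.e. triviality. [folklore] -/
theorem headInflux_le_budget_add_const (C : ℝ)
    (u : ℝ → EuclideanSpace ℝ (Fin 3) → EuclideanSpace ℝ (Fin 3))
    (p : ℝ → EuclideanSpace ℝ (Fin 3) → ℝ) (hu : IsTypeIAncientMild C u)
    (hD : Continuous (fun s : ℝ =>
      ∫ y, frobeniusNormSq (fderiv ℝ (lerayOrbit u s) y) * Real.exp (-‖y‖ ^ 2 / 4)))
    (hCh : Continuous (fun s : ℝ =>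
      ∫ y, (‖lerayOrbit u s y‖ ^ 2 / 2 + lerayOrbitPressure p s y) *
        ⟪y, lerayOrbit u s y⟫ * Real.exp (-‖y‖ ^ 2 / 4)))
    (hE' : ∀ s : ℝ,
      HasDerivAt (fun σ : ℝ => ∫ y, ‖lerayOrbit u σ y‖ ^ 2 / 2 * Real.exp (-‖y‖ ^ 2 / 4))
        (-(∫ y, frobeniusNormSq (fderiv ℝ (lerayOrbit u s) y) * Real.exp (-‖y‖ ^ 2 / 4))
          - (∫ y, ‖lerayOrbit u s y‖ ^ 2 / 2 * Real.exp (-‖y‖ ^ 2 / 4))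
          - (∫ y, (‖lerayOrbit u s y‖ ^ 2 / 2 + lerayOrbitPressure p s y) *
              ⟪y, lerayOrbit u s y⟫ * Real.exp (-‖y‖ ^ 2 / 4)) / 2) s)
    (a b : ℝ) :
    (∫ s in a..b, -(∫ y, (‖lerayOrbit u s y‖ ^ 2 / 2 + lerayOrbitPressure p s y) *
        ⟪y, lerayOrbit u s y⟫ * Real.exp (-‖y‖ ^ 2 / 4)) / 2) ≤
      (∫ s in a..b,
        ((∫ y, frobeniusNormSq (fderiv ℝ (lerayOrbit u s) y) * Real.exp (-‖y‖ ^ 2 / 4)) +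
          ∫ y, ‖lerayOrbit u s y‖ ^ 2 / 2 * Real.exp (-‖y‖ ^ 2 / 4))) +
        C ^ 2 / 2 * ∫ y : EuclideanSpace ℝ (Fin 3), Real.exp (-‖y‖ ^ 2 / 4) := by
  -- Gaussian bookkeeping as in the landed S3 file: `0 ≤ E ≤ ½C² ∫G`
  have hG := headFlux_integrable_gauss
  have hGc : Continuous fun y : EuclideanSpace ℝ (Fin 3) => Real.exp (-‖y‖ ^ 2 / 4) :=
    ((continuous_norm.pow 2).neg.div_const 4).rexp
  have hUc : ∀ s, Continuous (lerayOrbit u s) := headFlux_continuous_lerayOrbit hu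
  have hUC : ∀ s y, ‖lerayOrbit u s y‖ ≤ C := headFlux_norm_lerayOrbit_le hu
  have hIc : ∀ s, Continuous fun y =>
      ‖lerayOrbit u s y‖ ^ 2 / 2 * Real.exp (-‖y‖ ^ 2 / 4) := fun s =>
    (((hUc s).norm.pow 2).div_const 2).mul hGc
  have hnn : ∀ s y, 0 ≤ ‖lerayOrbit u s y‖ ^ 2 / 2 * Real.exp (-‖y‖ ^ 2 / 4) := fun s y => by
    positivity
  have hpt : ∀ s y, ‖lerayOrbit u s y‖ ^ 2 / 2 * Real.exp (-‖y‖ ^ 2 / 4) ≤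
      C ^ 2 / 2 * Real.exp (-‖y‖ ^ 2 / 4) := fun s y =>
    mul_le_mul_of_nonneg_right
      (div_le_div_of_nonneg_right (pow_le_pow_left₀ (norm_nonneg _) (hUC s y) 2) zero_le_two)
      (Real.exp_pos _).le
  have hint : ∀ s, Integrable fun y => ‖lerayOrbit u s y‖ ^ 2 / 2 * Real.exp (-‖y‖ ^ 2 / 4) :=
    fun s => (hG.const_mul (C ^ 2 / 2)).mono' (hIc s).aestronglyMeasurable
      (Eventually.of_forall fun y => by
        rw [Real.norm_of_nonneg (hnn s y)]
        exact hpt s y)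
  have hE0 : ∀ s, 0 ≤ ∫ y, ‖lerayOrbit u s y‖ ^ 2 / 2 * Real.exp (-‖y‖ ^ 2 / 4) := fun s =>
    integral_nonneg fun y => hnn s y
  have hEM : ∀ s, (∫ y, ‖lerayOrbit u s y‖ ^ 2 / 2 * Real.exp (-‖y‖ ^ 2 / 4)) ≤
      C ^ 2 / 2 * ∫ y : EuclideanSpace ℝ (Fin 3), Real.exp (-‖y‖ ^ 2 / 4) := fun s => by
    rw [← integral_const_mul]
    exact integral_mono (hint s) (hG.const_mul _) fun y => hpt s y
  exact influx_le_budget_add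
    (E := fun s => ∫ y, ‖lerayOrbit u s y‖ ^ 2 / 2 * Real.exp (-‖y‖ ^ 2 / 4))
    (D := fun s => ∫ y, frobeniusNormSq (fderiv ℝ (lerayOrbit u s) y) * Real.exp (-‖y‖ ^ 2 / 4))
    (Ch := fun s => ∫ y, (‖lerayOrbit u s y‖ ^ 2 / 2 + lerayOrbitPressure p s y) *
      ⟪y, lerayOrbit u s y⟫ * Real.exp (-‖y‖ ^ 2 / 4))
    hE0 hEM hD hCh hE' a b

end Summit.NavierStokesRegularity.NavierStokesRegularity.Theorems.TargetNegative.HeadInfluxLawCostume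

end
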